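import Literature.MathematicalPhysics.QuantumFieldTheory.CentreDominatedWilsonLoops
import Literature.MathematicalPhysics.QuantumFieldTheory.Z2WilsonLoopGKSUpper
import Literature.MathematicalPhysics.QuantumLattice.WilsonLoopsProofs
import Literature.Probability.LatticeModels.GKSBondDecoupling
import HarnessLib

/-!
# The area law of `ℤ₂` lattice gauge theory for `β < 1/(2(d-1))` by Griffiths inequalities
# (Tomboulis–Ukawa–Windey 1981 / Sá Barreto–O'Carroll 1983), and confinement of `SU(2)`,
# `SU(2m)` for `β < 1/(2N(d-1))` through the centre

Topic `MathematicalPhysics/QuantumFieldTheory`, namespace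
`Literature.MathematicalPhysics.QuantumFieldTheory`. Sequel of
`Literature/Probability/LatticeModels/GKSBondDecoupling.lean` (the one-site decoupling inequality
`⟨σ_A⟩ ≤ ∑_{i ∋ b} Kᵢ ⟨σ_{A ∆ Cᵢ}⟩` of a ferromagnetic generalised Ising system and its iterate
`⟨σ_A⟩ ≤ (mκ)^n`, `n` = minimal number of interaction sets spanning `A` mod 2), of
`Z2WilsonLoopGKS` / `CentreDominatedWilsonLoops` (the torus `ℤ₂` Wilson theory IS such a system:
`gksExpect_const_eq_wilsonExpectation_z2`, `wilsonLoop_z2Rep_eq_spinProduct`; centre domination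
`su2_hasAreaLaw_of_z2`, `hasAreaLaw_of_centre`, `specialUnitaryGroup_hasAreaLaw_of_z2_of_even`) and
of `Z2WilsonLoopGKSUpper` (`card_filter_mem_torusPlaqEdges_le`: a link lies on at most `2(d-1)`
plaquettes).

## The printed result

A. L. Mota, F. C. Sá Barreto, arXiv:2402.12277 (2024) [MotaSaBarreto2024], §2 "Mean field lower
bounds", eqs. (3)–(5), restating F. C. Sá Barreto, M. O'Carroll, J. Phys. A 16 (1983) L431
[SaBarretoOCarroll1983Z2] and E. Tomboulis, A. Ukawa, P. Windey, Nucl. Phys. B 180 (1981) 294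
[TomboulisUkawaWindey1981] (neither held; cited through the secondary): for `Z_N` lattice gauge
theory with Wilson action, a planar rectangle `C` of area `A` and `β ∈ (0, 1/(2(d-1)))`,

  `⟨W(C)⟩ ≤ [2(d-1)β]^A = e^{-|log(2β(d-1))| A}`                                      (5)

— area decay of the Wilson loop, i.e. confinement, for every `β < 1/(2(d-1))`, by Griffiths'
first and second inequalities alone (no cluster expansion). The printed setting is free boundary
conditions; the same argument runs verbatim on the discrete torus (where the tree's `ℤ₂` theory
and its `HasAreaLaw` currency live), the only torus-specific point being the geometric input below.

## What is proved (no named facts)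

* §1–§3 **the geometric input** `mul_le_card_of_oddSpan_eq_rectOddEdges`: on the torus
  `(ℤ/Lℤ)^d`, any set `S` of plaquettes whose mod-2 boundary (`oddSpan S torusPlaqEdges`) is the
  boundary link set of the `R × T` rectangle in the `(i,j)` plane (`rectOddEdges`), with
  `2R ≤ L`, `2T ≤ L`, has at least `R T` elements. Proof by `RT` disjoint `ℤ₂` "vortex"
  configurations: flipping the `j`-links of the slab `{y : yⱼ = xⱼ + b, xᵢ + a < yᵢ ≤ xᵢ + a + R}`
  reverses the sign of the Wilson loop (`wilsonLoop_slabCfg`) and of exactly the plaquettes of type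
  `{i,j}` over the two unit squares `(xᵢ + a, xⱼ + b)`, `(xᵢ + a + R, xⱼ + b)` (`detector`;
  `plaquette_slabCfg_eq_one` off the detector), while `σ_{∂S} = ∏_{p ∈ S} σ_{∂p}` for every spin
  configuration; so `S` meets every detector, and the detectors of distinct unit squares are
  disjoint. (This is the mod-2, base-point-free sibling of the slab twist of
  `LatticeGaugeTorusAreaLaw`, used there inside the polymer expansion.)
* §4 **the finite-volume bound** `z2_wilsonExpectation_wilsonLoop_le_pow`: for `β ≥ 0`, every torus
  `L ≥ 2`, base point, plane `i ≠ j` and `2R, 2T ≤ L`,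
  `0 ≤ ⟨W_{R×T}⟩_{ℤ₂,β,L} ≤ (2(d-1)β)^{RT}` (eq. (5) in finite volume with periodic b.c.).
* §5 **the area law** `z2_hasAreaLaw`: `0 ≤ β`, `2(d-1)β < 1 ⇒ HasAreaLaw d z2Rep β`
  (`C = 1`, `c = -log(2(d-1)β)`); `d = 4`: `β < 1/6` (`z2_hasAreaLaw_dim4`).
* §6 **confinement inherited from the centre, now unconditional at strong coupling**:
  `su2_hasAreaLaw_of_lt` (`4(d-1)β < 1`, i.e. `β < 1/12` in `d = 4`),
  `specialUnitaryGroup_hasAreaLaw_of_even_of_lt` (`SU(N)`, `N` even, `2N(d-1)β < 1`),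
  `hasAreaLaw_of_centre_of_lt` (any compact `G`, unitary `ρ` with a central involution `ρ(z) = -1`,
  `2N(d-1)β < 1`), and the limit-state forms `z2_hasAreaLawState`, `su2_hasAreaLawState`
  (every infinite-volume limit point, via `hasAreaLawState_of_hasAreaLaw_holds`).

HONEST LABEL. Strong-coupling statements (`β < 1/(2(d-1))` for `ℤ₂`, `β < 1/(4(d-1))` for `SU(2)`);
in `d = 4` the `ℤ₂` theory deconfines at weak coupling and `SU(N)` centre domination has content
only at strong coupling. The venture files `Summits/Ventures/YMGap/RobustBall/CentreBlind*` of the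
cell `pub-ymgap` reach larger `β` for even `N` by layer freezing + self-avoiding-walk counts
(Fisher); the present file is the Literature-level, expansion-free `HasAreaLaw` instance by the
printed correlation-inequality route. Nothing here bears on the continuum or on the mass gap.

## References

* A. L. Mota, F. C. Sá Barreto, arXiv:2402.12277 (2024), §2 eqs. (3)–(5). [MotaSaBarreto2024]
* F. C. Sá Barreto, M. O'Carroll, J. Phys. A 16 (1983) L431–L434. [SaBarretoOCarroll1983Z2]
* E. Tomboulis, A. Ukawa, P. Windey, Nucl. Phys. B 180 (1981) 294–300. [TomboulisUkawaWindey1981]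
* H. Grosse, *Models in Statistical Physics and Quantum Field Theory* (1988), §4.2.4 (4.134).
  [Grosse1988]
* S. Chatterjee, Comm. Math. Phys. 377 (2020) 307–340, §1.1. [arXiv181109770]
-/

noncomputable section

open MeasureTheory Finset
open scoped symmDiff
open Literature.Probability.LatticeModels Literature.MathematicalPhysics.QuantumLattice

namespace Literature.MathematicalPhysics.QuantumFieldTheory

namespace Z2AreaLawGKS

variable {d L : ℕ}

/-! ### §1 Arithmetic on `ℤ/Lℤ` -/

/-- Natural numbers below `L` with equal residues are equal. [folklore] -/
private theorem natCast_inj_of_lt {m n : ℕ} (hm : m < L) (hn : n < L) (h : (m : ZMod L) = n) :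
    m = n := by
  have h' := congrArg ZMod.val h
  rwa [ZMod.val_cast_of_lt hm, ZMod.val_cast_of_lt hn] at h'

/-- The cyclic interval `{c : 1 ≤ (c - c₀).val ≤ R}` of `ℤ/Lℤ` (`2R ≤ L`) contains exactly one of two
consecutive residues `c, c + 1` iff `(c - c₀).val ∈ {0, R}`; contrapositive form used below: off
these two values, `c` and `c + 1` are in or out together. [folklore] -/
private theorem mem_interval_iff_succ [NeZero L] [Fact (1 < L)] {R : ℕ} (hRL : 2 * R ≤ L)
    (z : ZMod L) (h0 : z.val ≠ 0) (hR : z.val ≠ R) :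
    (1 ≤ z.val ∧ z.val ≤ R) ↔ (1 ≤ (z + 1).val ∧ (z + 1).val ≤ R) := by
  have hzL : z.val < L := ZMod.val_lt z
  rw [ZMod.val_add, ZMod.val_one]
  by_cases hlt : z.val + 1 < L
  · rw [Nat.mod_eq_of_lt hlt]
    omega
  · have heq : z.val + 1 = L := by omega
    rw [heq, Nat.mod_self]
    omega

/-! ### §2 The slab configurations and their detectors -/

section Slab

variable [NeZero L] (x : Site d L) (i j : Fin d) (R : ℕ)

/-- **The slab of twisted links** for the unit square `(a, b)` of the `R × T` rectangle at `x` in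
the `(i, j)` plane: the `j`-links `(y, j)` with `yⱼ = xⱼ + b` and `xᵢ + a + 1 ≤ yᵢ ≤ xᵢ + a + R`
(cyclically). [folklore] -/
def slab (a b : ℕ) : Finset (Edge d L) :=
  Finset.univ.filter fun e => e.2 = j ∧ e.1 j = x j + b ∧
    1 ≤ (e.1 i - (x i + a)).val ∧ (e.1 i - (x i + a)).val ≤ R

/-- Membership in the slab, unfolded. [folklore] -/
private theorem mem_slab_iff {a b : ℕ} {e : Edge d L} :
    e ∈ slab x i j R a b ↔ e.2 = j ∧ e.1 j = x j + b ∧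
      1 ≤ (e.1 i - (x i + a)).val ∧ (e.1 i - (x i + a)).val ≤ R := by
  simp [slab]

/-- **The slab configuration**: the `ℤ₂` gauge field equal to the generator on the slab and trivial
elsewhere (a `ℤ₂` vortex sheet with boundary over the two unit squares `(xᵢ+a, xⱼ+b)` and
`(xᵢ+a+R, xⱼ+b)`). [folklore] -/
def slabCfg (a b : ℕ) : GaugeConfig d L (Multiplicative (ZMod 2)) :=
  fun e => if e ∈ slab x i j R a b then Multiplicative.ofAdd 1 else 1

/-- The link sign of the slab configuration. [folklore] -/
def linkSign (a b : ℕ) (y : Site d L) (m : Fin d) : ℝ :=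
  if m = j ∧ y j = x j + b ∧ 1 ≤ (y i - (x i + a)).val ∧ (y i - (x i + a)).val ≤ R then -1 else 1

/-- The character of a link variable of the slab configuration is its link sign. [folklore] -/
private theorem z2Character_slabCfg (a b : ℕ) (y : Site d L) (m : Fin d) :
    z2Character (slabCfg x i j R a b (y, m)) = linkSign x i j R a b y m := by
  unfold slabCfg linkSign
  by_cases h : (y, m) ∈ slab x i j R a b
  · rw [if_pos h, if_pos ((mem_slab_iff x i j R).1 h), z2Character_ofAdd_one]
  · rw [if_neg h, if_neg (fun h' => h ((mem_slab_iff x i j R).2 h')), z2Character_one]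

omit [NeZero L] in
/-- Links not in direction `j` are untwisted. [folklore] -/
private theorem linkSign_of_ne {a b : ℕ} (y : Site d L) {m : Fin d} (hm : m ≠ j) :
    linkSign x i j R a b y m = 1 := by
  unfold linkSign
  rw [if_neg (fun h => hm h.1)]

variable {x i j R}

omit [NeZero L] in
/-- A shift in a direction other than `i, j` does not change the link sign. [folklore] -/
private theorem linkSign_shift_of_ne {a b : ℕ} (y : Site d L) {l : Fin d} (hlj : l ≠ j) (hli : l ≠ i)
    (m : Fin d) : linkSign x i j R a b (y.shift l) m = linkSign x i j R a b y m := by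
  unfold linkSign Site.shift
  rw [Pi.add_apply, Pi.add_apply, Pi.single_eq_of_ne (Ne.symm hlj), Pi.single_eq_of_ne (Ne.symm hli),
    add_zero, add_zero]

/-- **The curvature of the slab configuration is supported on the detector**: for the two
`j`-links `(y, j)`, `(y + eᵢ, j)` of a plaquette of type `{i, j}` at `y`, the product of the link
signs is `1` unless `yⱼ = xⱼ + b` and `yᵢ ∈ {xᵢ + a, xᵢ + a + R}`. [folklore] -/
private theorem linkSign_mul_linkSign_shift [Fact (1 < L)] (hij : i ≠ j) {a b : ℕ} (haR : a < R)
    (hRL : 2 * R ≤ L) (y : Site d L)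
    (h : ¬(y j = x j + b ∧ (y i = x i + a ∨ y i = x i + a + R))) :
    linkSign x i j R a b y j * linkSign x i j R a b (y.shift i) j = 1 := by
  unfold linkSign
  have hsj : (y.shift i) j = y j := by
    unfold Site.shift; rw [Pi.add_apply, Pi.single_eq_of_ne (Ne.symm hij), add_zero]
  have hsi : (y.shift i) i = y i + 1 := by
    unfold Site.shift; rw [Pi.add_apply, Pi.single_eq_same]
  rw [hsj, hsi]
  by_cases hrow : y j = x j + b
  · have hcol : ¬(y i = x i + a ∨ y i = x i + a + R) := fun hc => h ⟨hrow, hc⟩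
    set z : ZMod L := y i - (x i + a) with hz
    have hz' : y i + 1 - (x i + a) = z + 1 := by rw [hz]; ring
    have h0 : z.val ≠ 0 := by
      intro h0
      apply hcol
      left
      have : z = 0 := (ZMod.val_eq_zero z).1 h0
      rw [hz, sub_eq_zero] at this
      exact this
    have hR : z.val ≠ R := by
      intro hR
      apply hcol
      right
      have hRL' : R < L := by omega
      have : z = (R : ZMod L) := by
        apply ZMod.val_injective
        rw [hR, ZMod.val_cast_of_lt hRL']
      rw [hz, sub_eq_iff_eq_add] at this
      rw [this]; ring
    have key := mem_interval_iff_succ hRL z h0 hR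
    rw [hz']
    simp only [hrow, true_and]
    by_cases hin : 1 ≤ z.val ∧ z.val ≤ R
    · rw [if_pos hin, if_pos (key.1 hin)]; norm_num
    · rw [if_neg hin, if_neg (fun h' => hin (key.2 h'))]; norm_num
  · simp [hrow]

variable (x i j R)

/-- **The detector** of the unit square `(a, b)`: the plaquettes of type `{i, j}` whose base point
`y` has `yⱼ = xⱼ + b` and `yᵢ ∈ {xᵢ + a, xᵢ + a + R}` — the support of the curvature of the slab
configuration. [folklore] -/
def detector (a b : ℕ) : Finset (Plaquette d L) :=
  Finset.univ.filter fun p => ((p.2.1.1 = i ∧ p.2.1.2 = j) ∨ (p.2.1.1 = j ∧ p.2.1.2 = i)) ∧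
    p.1 j = x j + b ∧ (p.1 i = x i + a ∨ p.1 i = x i + a + R)

/-- Membership in the detector, unfolded. [folklore] -/
private theorem mem_detector_iff {a b : ℕ} {p : Plaquette d L} :
    p ∈ detector x i j R a b ↔ ((p.2.1.1 = i ∧ p.2.1.2 = j) ∨ (p.2.1.1 = j ∧ p.2.1.2 = i)) ∧
      p.1 j = x j + b ∧ (p.1 i = x i + a ∨ p.1 i = x i + a + R) := by
  simp [detector]

variable {x i j R}

/-- **Off the detector the slab configuration is flat**: the `ℤ₂` plaquette variable of the slab
configuration is `+1` at every plaquette not in the detector of its unit square. [folklore] -/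
private theorem plaquette_slabCfg_eq_one [Fact (1 < L)] (hij : i ≠ j) {a b : ℕ} (haR : a < R)
    (hRL : 2 * R ≤ L) (p : Plaquette d L) (hp : p ∉ detector x i j R a b) :
    z2Character (plaquetteHolonomy (slabCfg x i j R a b) p.1 p.2.1.1 p.2.1.2) = 1 := by
  obtain ⟨y, ⟨k, l⟩, hkl⟩ := p
  have hkl' : k ≠ l := ne_of_lt hkl
  rw [mem_detector_iff] at hp
  simp only at hp ⊢
  rw [z2Character_plaquetteHolonomy]
  simp only [z2Character_slabCfg]
  by_cases hk : k = j
  · subst hk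
    have hl : l ≠ k := Ne.symm hkl'
    rw [linkSign_of_ne x i k R _ hl, linkSign_of_ne x i k R _ hl, mul_one, mul_one]
    by_cases hli : l = i
    · subst hli
      have h' : ¬(y k = x k + b ∧ (y l = x l + a ∨ y l = x l + a + R)) := fun h'' =>
        hp ⟨Or.inr ⟨rfl, rfl⟩, h''.1, h''.2⟩
      rw [linkSign_mul_linkSign_shift hij haR hRL y h']
    · rw [linkSign_shift_of_ne y hl hli, ← sq, linkSign]
      split_ifs <;> norm_num
  · by_cases hl : l = j
    · subst hl
      rw [linkSign_of_ne x i l R _ hk, linkSign_of_ne x i l R _ hk, one_mul, mul_one]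
      by_cases hki : k = i
      · subst hki
        have h' : ¬(y l = x l + b ∧ (y k = x k + a ∨ y k = x k + a + R)) := fun h'' =>
          hp ⟨Or.inl ⟨rfl, rfl⟩, h''.1, h''.2⟩
        rw [mul_comm, linkSign_mul_linkSign_shift hij haR hRL y h']
      · rw [linkSign_shift_of_ne y hk hki, ← sq, linkSign]
        split_ifs <;> norm_num
    · rw [linkSign_of_ne x i j R _ hk, linkSign_of_ne x i j R _ hl, linkSign_of_ne x i j R _ hk,
        linkSign_of_ne x i j R _ hl]
      norm_num

/-! ### §3 The slab configuration reverses the Wilson loop; the area bound -/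

omit [NeZero L] in
/-- The character of a line holonomy is the product of the link characters along the line,
indexed by the step number. [folklore] -/
private theorem z2Character_lineHolonomy_eq_prod (U : GaugeConfig d L (Multiplicative (ZMod 2)))
    (k : Fin d) : ∀ (n : ℕ) (y : Site d L), z2Character (lineHolonomy U k n y) =
      ∏ t ∈ Finset.range n, z2Character (U (y + ((t : ℕ) : ZMod L) • Pi.single k 1, k))
  | 0, y => by simp [lineHolonomy]
  | n + 1, y => by
      rw [show lineHolonomy U k (n + 1) y = U (y, k) * lineHolonomy U k n (y.shift k) from rfl,
        z2Character_mul, z2Character_lineHolonomy_eq_prod U k n (y.shift k), Finset.prod_range_succ',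
        Nat.cast_zero, zero_smul, add_zero, mul_comm]
      congr 1
      refine Finset.prod_congr rfl fun t _ => ?_
      congr 2
      unfold Site.shift
      rw [Nat.cast_succ, add_smul, one_smul]
      abel

/-- **The slab configuration reverses the Wilson loop**: `W^{ℤ₂}_{R×T}(slabCfg a b) = -1` for
`a < R`, `b < T`, `2R ≤ L`, `2T ≤ L` (exactly one link of the loop, on its far `j`-side, is
twisted). [folklore] -/
private theorem wilsonLoop_slabCfg [Fact (1 < L)] (hij : i ≠ j) {R T a b : ℕ} (haR : a < R) (hbT : b < T)
    (hRL : 2 * R ≤ L) (hTL : 2 * T ≤ L) :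
    wilsonLoop z2Rep x i j R T (slabCfg x i j R a b) = -1 := by
  have hL1 : 1 < L := Fact.out
  rw [wilsonLoop_z2Rep_eq_z2Character, rectangleHolonomy]
  simp only [z2Character_mul, z2Character_inv, z2Character_lineHolonomy_eq_prod, z2Character_slabCfg]
  -- the two `i`-sides are untwisted
  rw [Finset.prod_eq_one (fun t _ => linkSign_of_ne x i j R _ hij),
    Finset.prod_eq_one (fun t _ => linkSign_of_ne x i j R _ hij), one_mul, mul_one]
  -- the near `j`-side is untwisted: its column offset is `-a`
  have hnear : ∀ t ∈ Finset.range T,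
      linkSign x i j R a b ((x + ((t : ℕ) : ZMod L) • Pi.single j (1 : ZMod L) : Site d L)) j = 1 := by
    intro t _
    unfold linkSign
    rw [if_neg]
    rintro ⟨-, -, h1, h2⟩
    have hcol : ((x + ((t : ℕ) : ZMod L) • Pi.single j (1 : ZMod L) : Site d L)) i - (x i + a) =
        -(a : ZMod L) := by
      rw [Pi.add_apply, Pi.smul_apply, Pi.single_eq_of_ne hij, smul_zero, add_zero]; ring
    rw [hcol, ZMod.neg_val] at h1 h2
    have haL : a < L := by omega
    have hav : (a : ZMod L).val = a := ZMod.val_cast_of_lt haL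
    by_cases ha0 : (a : ZMod L) = 0
    · rw [if_pos ha0] at h1; omega
    · rw [if_neg ha0, hav] at h2
      have : a ≠ 0 := fun h => ha0 (by rw [h, Nat.cast_zero])
      omega
  rw [Finset.prod_eq_one hnear, mul_one]
  -- the far `j`-side: exactly the link at height `b` is twisted
  have hfar : ∀ t ∈ Finset.range T,
      linkSign x i j R a b
          ((x + Pi.single i ((R : ℕ) : ZMod L) + ((t : ℕ) : ZMod L) • Pi.single j (1 : ZMod L) : Site d L)) j =
        if t = b then -1 else 1 := by
    intro t ht
    rw [Finset.mem_range] at ht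
    unfold linkSign
    have hrow : ((x + Pi.single i ((R : ℕ) : ZMod L) + ((t : ℕ) : ZMod L) • Pi.single j (1 : ZMod L) :
        Site d L)) j = x j + t := by
      rw [Pi.add_apply, Pi.add_apply, Pi.smul_apply, Pi.single_eq_of_ne (Ne.symm hij), Pi.single_eq_same,
        smul_eq_mul, mul_one, add_zero]
    have hcol : ((x + Pi.single i ((R : ℕ) : ZMod L) + ((t : ℕ) : ZMod L) • Pi.single j (1 : ZMod L) :
        Site d L)) i - (x i + a) = ((R - a : ℕ) : ZMod L) := by
      rw [Pi.add_apply, Pi.add_apply, Pi.smul_apply, Pi.single_eq_same, Pi.single_eq_of_ne hij,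
        smul_zero, add_zero, Nat.cast_sub haR.le]
      ring
    have hRa : ((R - a : ℕ) : ZMod L).val = R - a := ZMod.val_cast_of_lt (by omega)
    rw [hrow, hcol, hRa]
    by_cases htb : t = b
    · subst htb
      rw [if_pos ⟨rfl, rfl, by omega, by omega⟩, if_pos rfl]
    · rw [if_neg, if_neg htb]
      rintro ⟨-, h, -, -⟩
      exact htb (natCast_inj_of_lt (by omega) (by omega) (add_left_cancel h))
  rw [Finset.prod_congr rfl hfar, Finset.prod_ite_eq']
  rw [if_pos (Finset.mem_range.2 hbT)]

/-- **A spanning set meets every detector.** If the mod-2 boundary of the set of plaquettes `S`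
is the boundary link set of the `R × T` rectangle, then `S` contains a plaquette of the detector
of every unit square `(a, b)`, `a < R`, `b < T`. [folklore] -/
private theorem exists_mem_detector_of_oddSpan_eq [Fact (1 < L)] (hij : i ≠ j) {R T : ℕ} (hRL : 2 * R ≤ L)
    (hTL : 2 * T ≤ L) {S : Finset (Plaquette d L)}
    (hS : oddSpan S torusPlaqEdges = rectOddEdges x i j R T) {a b : ℕ} (haR : a < R) (hbT : b < T) :
    ∃ p ∈ S, p ∈ detector x i j R a b := by
  classical
  by_contra hne
  push Not at hne
  set U := slabCfg x i j R a b with hU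
  have h1 : spinProduct (rectOddEdges x i j R T) (spinCfg U) = -1 := by
    rw [← wilsonLoop_z2Rep_eq_spinProduct, hU, wilsonLoop_slabCfg hij haR hbT hRL hTL]
  have h2 : spinProduct (rectOddEdges x i j R T) (spinCfg U) = 1 := by
    rw [← hS, spinProduct_oddSpan]
    refine Finset.prod_eq_one fun p hp => ?_
    rw [spinProduct_torusPlaqEdges]
    exact plaquette_slabCfg_eq_one hij haR hRL p (hne p hp)
  rw [h2] at h1
  norm_num at h1

/-- Detectors of distinct unit squares are disjoint (`2R ≤ L`, `2T ≤ L`). [folklore] -/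
private theorem eq_of_mem_detector {R T a b a' b' : ℕ} (hRL : 2 * R ≤ L) (hTL : 2 * T ≤ L)
    (haR : a < R) (hbT : b < T) (haR' : a' < R) (hbT' : b' < T) {p : Plaquette d L}
    (hp : p ∈ detector x i j R a b) (hp' : p ∈ detector x i j R a' b') : a = a' ∧ b = b' := by
  rw [mem_detector_iff] at hp hp'
  obtain ⟨-, hrow, hcol⟩ := hp
  obtain ⟨-, hrow', hcol'⟩ := hp'
  refine ⟨?_, ?_⟩
  · have e1 : ((a + R : ℕ) : ZMod L) = (a : ZMod L) + R := by push_cast; ring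
    have e2 : ((a' + R : ℕ) : ZMod L) = (a' : ZMod L) + R := by push_cast; ring
    rcases hcol with h | h <;> rcases hcol' with h' | h'
    · exact natCast_inj_of_lt (by omega) (by omega) (add_left_cancel (h.symm.trans h'))
    · have := h.symm.trans h'
      rw [add_assoc, ← e2] at this
      have := natCast_inj_of_lt (by omega) (by omega) (add_left_cancel this)
      omega
    · have := h.symm.trans h'
      rw [add_assoc, ← e1] at this
      have := natCast_inj_of_lt (by omega) (by omega) (add_left_cancel this)
      omega
    · have := h.symm.trans h'
      rw [add_assoc, add_assoc, ← e1, ← e2] at this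
      have := natCast_inj_of_lt (by omega) (by omega) (add_left_cancel this)
      omega
  · exact natCast_inj_of_lt (by omega) (by omega) (add_left_cancel (hrow.symm.trans hrow'))

/-- **The area bound for spanning sets on the torus.** If the mod-2 boundary of a set `S` of
plaquettes of the torus `(ℤ/Lℤ)^d` is the boundary of the `R × T` rectangle in the `(i, j)`
plane, `i ≠ j`, `2R ≤ L`, `2T ≤ L`, then `R T ≤ |S|` (one plaquette in each of the `RT` pairwise
disjoint detectors). This is the geometric content of "after `A` applications" in the printed
argument (a rectangle of area `A` is not spanned by fewer than `A` plaquettes).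
[cite: MotaSaBarreto2024, §2 (text between eqs. (3) and (4))] -/
theorem mul_le_card_of_oddSpan_eq_rectOddEdges (hij : i ≠ j) {R T : ℕ} (hRL : 2 * R ≤ L)
    (hTL : 2 * T ≤ L) {S : Finset (Plaquette d L)}
    (hS : oddSpan S torusPlaqEdges = rectOddEdges x i j R T) : R * T ≤ #S := by
  classical
  rcases Nat.eq_zero_or_pos R with hR0 | hRpos
  · simp [hR0]
  haveI : Fact (1 < L) := ⟨by omega⟩
  haveI : Nonempty (Plaquette d L) := by
    rcases lt_or_gt_of_ne hij with h | h
    · exact ⟨⟨x, ⟨(i, j), h⟩⟩⟩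
    · exact ⟨⟨x, ⟨(j, i), h⟩⟩⟩
  have hch : ∀ ab ∈ Finset.range R ×ˢ Finset.range T, ∃ p ∈ S, p ∈ detector x i j R ab.1 ab.2 := by
    intro ab hab
    rw [Finset.mem_product, Finset.mem_range, Finset.mem_range] at hab
    exact exists_mem_detector_of_oddSpan_eq hij hRL hTL hS hab.1 hab.2
  choose! f hfS hfD using hch
  calc R * T = #(Finset.range R ×ˢ Finset.range T) := by
        rw [Finset.card_product, Finset.card_range, Finset.card_range]
    _ ≤ #S := by
        refine Finset.card_le_card_of_injOn f (fun ab hab => hfS ab hab) ?_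
        intro ab hab ab' hab' hff
        have hab₀ := hab
        have hab₀' := hab'
        rw [Finset.mem_coe, Finset.mem_product, Finset.mem_range, Finset.mem_range] at hab₀ hab₀'
        have hD := hfD ab hab
        have hD' := hfD ab' hab'
        rw [hff] at hD
        obtain ⟨h1, h2⟩ := eq_of_mem_detector hRL hTL hab₀'.1 hab₀'.2 hab₀.1 hab₀.2 hD' hD
        exact Prod.ext h1.symm h2.symm

end Slab

end Z2AreaLawGKS

/-! ### §4 The finite-volume bound `⟨W_{R×T}⟩_{ℤ₂,β,L} ≤ (2(d-1)β)^{RT}` -/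

section FiniteVolume

open Z2AreaLawGKS

variable {d L : ℕ} [NeZero L] [Fact (1 < L)]

/-- The `ℤ₂` torus Wilson loop expectation is the correlation `⟨σ_{∂(R×T)}⟩` of the ferromagnetic
plaquette system with uniform coupling `β`. [cite: arXiv181109770, §1.1 (1.1)–(1.3)] -/
theorem wilsonExpectation_z2_wilsonLoop_eq_gksExpect (β : ℝ) (x : Site d L) (i j : Fin d) (R T : ℕ) :
    wilsonExpectation (L := L) z2Rep β (wilsonLoop z2Rep x i j R T) =
      gksExpect (Finset.univ : Finset (Plaquette d L)) (fun _ => β) torusPlaqEdges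
        (spinProduct (rectOddEdges x i j R T)) := by
  classical
  rw [gksExpect_const_eq_wilsonExpectation_z2]
  congr 1
  funext σ
  exact wilsonLoop_z2Rep_eq_spinProduct σ x i j R T

/-- **Griffiths' first inequality for the rectangular `ℤ₂` Wilson loops**: `0 ≤ ⟨W_{R×T}⟩_{ℤ₂,β,L}`
for `β ≥ 0`. [cite: arXiv181109770, Lemma 7.2] -/
theorem z2_wilsonExpectation_wilsonLoop_nonneg {β : ℝ} (hβ : 0 ≤ β) (x : Site d L) (i j : Fin d)
    (R T : ℕ) : 0 ≤ wilsonExpectation (L := L) z2Rep β (wilsonLoop z2Rep x i j R T) := by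
  rw [wilsonExpectation_z2_wilsonLoop_eq_gksExpect]
  exact gksExpect_spinProduct_nonneg _ _ _ (fun _ _ => hβ) _

omit [Fact (1 < L)] in
/-- **The one-link decoupling inequality for `ℤ₂` Wilson loops on the torus** (Tomboulis–Ukawa–Windey
1981; Sá Barreto–O'Carroll 1983; Mota–Sá Barreto 2024, eq. (3)): for `β ≥ 0` and a link `e` of the
loop's boundary set `A = ∂(R×T)`,
`⟨σ_A⟩_{ℤ₂,β,L} ≤ β ∑_{p ∋ e} ⟨σ_{A ∆ ∂p}⟩_{ℤ₂,β,L}`, the sum over the (at most `2(d-1)`) plaquettes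
containing `e`. [cite: MotaSaBarreto2024, §2 eq. (3)] -/
theorem z2_gksExpect_rectOddEdges_le_decouple {β : ℝ} (hβ : 0 ≤ β) (x : Site d L) (i j : Fin d)
    (R T : ℕ) {e : Edge d L} (he : e ∈ rectOddEdges x i j R T) :
    gksExpect (Finset.univ : Finset (Plaquette d L)) (fun _ => β) torusPlaqEdges
        (spinProduct (rectOddEdges x i j R T)) ≤
      β * ∑ p ∈ Finset.univ.filter (fun p : Plaquette d L => e ∈ torusPlaqEdges p),
        gksExpect (Finset.univ : Finset (Plaquette d L)) (fun _ => β) torusPlaqEdges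
          (spinProduct (rectOddEdges x i j R T ∆ torusPlaqEdges p)) :=
  gksExpect_spinProduct_le_mul_sum_decouple _ _ hβ he

/-- **Area decay of `ℤ₂` Wilson loops in finite volume** (Tomboulis–Ukawa–Windey 1981;
Sá Barreto–O'Carroll 1983; Mota–Sá Barreto 2024, §2 eqs. (4)–(5), on the torus): for `β ≥ 0`,
every torus `(ℤ/Lℤ)^d` with `L ≥ 2`, base point `x`, plane `i ≠ j` and side lengths with
`2R ≤ L`, `2T ≤ L`,

  `⟨W_{R×T}⟩_{ℤ₂,β,L} ≤ (2(d-1) β)^{R T}`.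

Proof: the iterated decoupling bound `gksExpect_const_spinProduct_le_pow` with `m = 2(d-1)`
plaquettes through a link and spanning number `RT` (`mul_le_card_of_oddSpan_eq_rectOddEdges`).
[cite: MotaSaBarreto2024, §2 eqs. (4)–(5)] -/
theorem z2_wilsonExpectation_wilsonLoop_le_pow {β : ℝ} (hβ : 0 ≤ β) (x : Site d L) {i j : Fin d}
    (hij : i ≠ j) {R T : ℕ} (hRL : 2 * R ≤ L) (hTL : 2 * T ≤ L) :
    wilsonExpectation (L := L) z2Rep β (wilsonLoop z2Rep x i j R T) ≤
      (2 * ((d - 1 : ℕ) : ℝ) * β) ^ (R * T) := by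
  classical
  rw [wilsonExpectation_z2_wilsonLoop_eq_gksExpect]
  have h := gksExpect_const_spinProduct_le_pow (Finset.univ : Finset (Plaquette d L))
    (torusPlaqEdges : Plaquette d L → Finset (Edge d L)) hβ (m := 2 * (d - 1))
    (fun e => card_filter_mem_torusPlaqEdges_le e) (A := rectOddEdges x i j R T) (n := R * T)
    (fun S _ hS => mul_le_card_of_oddSpan_eq_rectOddEdges hij hRL hTL hS)
  convert h using 2
  push_cast
  ring

/-- The printed exponential form: `⟨W_{R×T}⟩_{ℤ₂,β,L} ≤ e^{-|log(2(d-1)β)| RT}` for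
`0 < 2(d-1)β < 1`. [cite: MotaSaBarreto2024, §2 eq. (5)] -/
theorem z2_wilsonExpectation_wilsonLoop_le_exp {β : ℝ} (hβ : 0 ≤ β) (hpos : 0 < 2 * ((d - 1 : ℕ) : ℝ) * β)
    (x : Site d L) {i j : Fin d} (hij : i ≠ j) {R T : ℕ} (hRL : 2 * R ≤ L) (hTL : 2 * T ≤ L) :
    wilsonExpectation (L := L) z2Rep β (wilsonLoop z2Rep x i j R T) ≤
      Real.exp (-(-Real.log (2 * ((d - 1 : ℕ) : ℝ) * β)) * (R * T)) := by
  refine (z2_wilsonExpectation_wilsonLoop_le_pow hβ x hij hRL hTL).trans (le_of_eq ?_)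
  rw [neg_neg, show Real.log (2 * ((d - 1 : ℕ) : ℝ) * β) * ((R : ℝ) * T) =
      ((R * T : ℕ) : ℝ) * Real.log (2 * ((d - 1 : ℕ) : ℝ) * β) by push_cast; ring,
    ← Real.log_pow, Real.exp_log (pow_pos hpos _)]

end FiniteVolume

/-! ### §5 The area law of the `ℤ₂` theory at `β < 1/(2(d-1))` -/

section AreaLaw

variable {d : ℕ}

/-- **THE AREA LAW OF `ℤ₂` LATTICE GAUGE THEORY AT STRONG COUPLING BY GRIFFITHS INEQUALITIES**
(Tomboulis–Ukawa–Windey 1981; Sá Barreto–O'Carroll 1983; Mota–Sá Barreto 2024 §2 (5)): for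
`0 ≤ β` with `2(d-1)β < 1`, the tree's volume-uniform torus area law `HasAreaLaw d z2Rep β` holds,
with `C = 1` and `c = -log(2(d-1)β)` (any `c > 0` when `β = 0` or `d ≤ 1`):
`|⟨W_{R×T}⟩_{ℤ₂,β,L}| ≤ e^{-c RT}` for all `L`, planes, `1 ≤ R, T ≤ L/2`. No cluster expansion
is used. [cite: MotaSaBarreto2024, §2 eq. (5)] -/
theorem z2_hasAreaLaw {β : ℝ} (hβ : 0 ≤ β) (hβd : 2 * ((d - 1 : ℕ) : ℝ) * β < 1) :
    HasAreaLaw d z2Rep β := by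
  classical
  by_cases hpos : 0 < 2 * ((d - 1 : ℕ) : ℝ) * β
  · refine ⟨1, -Real.log (2 * ((d - 1 : ℕ) : ℝ) * β), ?_, ?_⟩
    · rw [neg_pos]
      exact Real.log_neg hpos hβd
    · intro L _ x i j R T hij hR hT hRL hTL
      haveI : Fact (1 < L) := ⟨by omega⟩
      rw [one_pow, one_mul, abs_of_nonneg (z2_wilsonExpectation_wilsonLoop_nonneg hβ x i j R T)]
      exact z2_wilsonExpectation_wilsonLoop_le_exp hβ hpos x hij hRL hTL
  · refine ⟨1, 1, one_pos, ?_⟩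
    intro L _ x i j R T hij hR hT hRL hTL
    haveI : Fact (1 < L) := ⟨by omega⟩
    have h0 : 2 * ((d - 1 : ℕ) : ℝ) * β = 0 :=
      le_antisymm (not_lt.1 hpos) (mul_nonneg (by positivity) hβ)
    have hle := z2_wilsonExpectation_wilsonLoop_le_pow hβ x hij hRL hTL
    rw [h0, zero_pow (Nat.mul_ne_zero (by omega) (by omega))] at hle
    rw [abs_of_nonneg (z2_wilsonExpectation_wilsonLoop_nonneg hβ x i j R T), one_pow, one_mul]
    exact hle.trans (Real.exp_pos _).le

/-- `d = 4`: the `ℤ₂` lattice gauge theory satisfies the area law for `0 ≤ β < 1/6`.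
[cite: MotaSaBarreto2024, §2 eq. (5)] -/
theorem z2_hasAreaLaw_dim4 {β : ℝ} (hβ : 0 ≤ β) (hβ6 : 6 * β < 1) : HasAreaLaw 4 z2Rep β :=
  z2_hasAreaLaw hβ (by norm_num; linarith)

/-- **Area law for every infinite-volume limit state of the `ℤ₂` theory** at `2(d-1)β < 1`
(`d ≥ 2`): `|W_μ(R,T)| ≤ e^{-cRT}` for every `μ ∈ infiniteVolumeLimitPoints z2Rep β`.
[cite: MotaSaBarreto2024, §2 eq. (5)] -/
theorem z2_hasAreaLawState [NeZero d] (hd : 2 ≤ d) {β : ℝ} (hβ : 0 ≤ β)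
    (hβd : 2 * ((d - 1 : ℕ) : ℝ) * β < 1) {μ : Measure (LGConfig d (Multiplicative (ZMod 2)))}
    (hμ : μ ∈ infiniteVolumeLimitPoints z2Rep β) :
    HasAreaLawState μ (fun g => normalisedCharacter 1 (z2Rep g)) :=
  hasAreaLawState_of_hasAreaLaw_holds (d := d) z2Rep hd continuous_of_discreteTopology (z2_hasAreaLaw hβ hβd) hμ

end AreaLaw

/-! ### §6 Confinement inherited from the centre, unconditional at strong coupling -/

section Centre

variable {d : ℕ}

/-- **`SU(2)` lattice gauge theory confines for `β < 1/(4(d-1))`, by correlation inequalities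
alone**: centre domination `|⟨W⟩_{SU(2),β}| ≤ ⟨W⟩_{ℤ₂,2β}` (Fröhlich 1979; Mack–Petkova 1979;
Grosse 1988 (4.134), tree `su2_hasAreaLaw_of_z2`) and the Griffiths-inequality area law of the
`ℤ₂` theory at `2β < 1/(2(d-1))`. [cite: Grosse1988, §4.2.4 (text after eq. (4.134))] -/
theorem su2_hasAreaLaw_of_lt {β : ℝ} (hβ : 0 ≤ β) (hβd : 4 * ((d - 1 : ℕ) : ℝ) * β < 1) :
    HasAreaLaw d (fundamentalRep (Fin 2)) β :=
  su2_hasAreaLaw_of_z2 hβ (z2_hasAreaLaw (by linarith) (by linarith))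

/-- `d = 4`: `SU(2)` lattice gauge theory satisfies the area law for `0 ≤ β < 1/12` (tree
normalisation `W = ½ tr`, Wilson weight `exp(-β S)`). [cite: Grosse1988, §4.2.4 (text after eq. (4.134))] -/
theorem su2_hasAreaLaw_dim4 {β : ℝ} (hβ : 0 ≤ β) (hβ12 : 12 * β < 1) :
    HasAreaLaw 4 (fundamentalRep (Fin 2)) β :=
  su2_hasAreaLaw_of_lt hβ (by norm_num; linarith)

/-- **`SU(N)`, `N` even, confines for `β < 1/(2N(d-1))`**: centre domination through `-𝟙 ∈ SU(N)`
(tree `specialUnitaryGroup_hasAreaLaw_of_z2_of_even`) and the `ℤ₂` area law at `Nβ`.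
[cite: Grosse1988, §4.2.4 (text after eq. (4.134))] -/
theorem specialUnitaryGroup_hasAreaLaw_of_even_of_lt {N : ℕ} (hN : Even N) {β : ℝ} (hβ : 0 ≤ β)
    (hβd : 2 * ((d - 1 : ℕ) : ℝ) * ((N : ℝ) * β) < 1) :
    HasAreaLaw d (fundamentalRep (Fin N)) β :=
  specialUnitaryGroup_hasAreaLaw_of_z2_of_even hN hβ (z2_hasAreaLaw (by positivity) hβd)

variable {N : ℕ} {G : Type*} [Group G] [TopologicalSpace G] [IsTopologicalGroup G]
  [CompactSpace G] [MeasurableSpace G] [BorelSpace G] (ρ : G →* Matrix (Fin N) (Fin N) ℂ)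

/-- **Confinement from a central involution, unconditional at strong coupling**: for every compact
gauge group `G`, continuous unitary `ρ` on `ℂ^N` and central `z` with `z² = 1`, `ρ(z) = -1`, the
`G`-theory satisfies the area law whenever `0 ≤ β` and `2N(d-1)β < 1` (tree `hasAreaLaw_of_centre`
with the `ℤ₂` area law at `Nβ`). [cite: Grosse1988, §4.2.4 (text after eq. (4.134))] -/
theorem hasAreaLaw_of_centre_of_lt (hρ : Continuous ρ) (hρu : ∀ g, ρ g ∈ Matrix.unitaryGroup (Fin N) ℂ)
    {z : G} (hzc : z ∈ Subgroup.center G) (hz2 : z * z = 1) (hρz : ρ z = -1) {β : ℝ} (hβ : 0 ≤ β)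
    (hβd : 2 * ((d - 1 : ℕ) : ℝ) * ((N : ℝ) * β) < 1) : HasAreaLaw d ρ β :=
  hasAreaLaw_of_centre ρ hρ hρu hzc hz2 hρz hβ (z2_hasAreaLaw (by positivity) hβd)

/-- **Area law for every infinite-volume limit state of `SU(2)`** at `4(d-1)β < 1` (`d ≥ 2`).
[cite: Grosse1988, §4.2.4 (text after eq. (4.134))] -/
theorem su2_hasAreaLawState [NeZero d] (hd : 2 ≤ d) {β : ℝ} (hβ : 0 ≤ β)
    (hβd : 4 * ((d - 1 : ℕ) : ℝ) * β < 1)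
    {μ : Measure (LGConfig d (Matrix.specialUnitaryGroup (Fin 2) ℂ))}
    (hμ : μ ∈ infiniteVolumeLimitPoints (fundamentalRep (Fin 2)) β) :
    HasAreaLawState μ (fun g => normalisedCharacter 2 (fundamentalRep (Fin 2) g)) := by
  haveI : SecondCountableTopology (Matrix.specialUnitaryGroup (Fin 2) ℂ) := by
    haveI : SecondCountableTopology (Matrix (Fin 2) (Fin 2) ℂ) :=
      inferInstanceAs (SecondCountableTopology (Fin 2 → Fin 2 → ℂ))
    exact TopologicalSpace.Subtype.secondCountableTopology (α := Matrix (Fin 2) (Fin 2) ℂ) _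
  exact hasAreaLawState_of_hasAreaLaw_holds (d := d) (fundamentalRep (Fin 2)) hd
    (continuous_fundamentalRep (Fin 2)) (su2_hasAreaLaw_of_lt hβ hβd) hμ

end Centre

/-! ### §7 Explicit limit-state area laws and string-tension lower bounds -/

section StringTension

variable {d : ℕ} [NeZero d]

/-- `(0 : Fin d) ≠ 1` for `d ≥ 2`. [folklore] -/
private theorem fin_zero_ne_one' (hd : 2 ≤ d) : (0 : Fin d) ≠ 1 := by
  intro h01
  have := congrArg Fin.val h01
  rw [Fin.val_zero, Fin.val_one', Nat.one_mod_eq_one.mpr (by omega)] at this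
  exact zero_ne_one this

/-- **Explicit area law for the `ℤ₂` limit states**: for `d ≥ 2`, `0 ≤ β`, `0 < 2(d-1)β`, every
infinite-volume limit point `μ` of the `ℤ₂` torus states satisfies
`|W_μ(R,T)| ≤ e^{log(2(d-1)β) RT}` for all `R, T ≥ 1`, i.e. `HasAreaLawWith μ χ 1 (-log(2(d-1)β))`
(the finite-volume bound `z2_wilsonExpectation_wilsonLoop_le_pow` is closed and passes to the
limit, `abs_rectExpectation_le_of_eventually`). [cite: MotaSaBarreto2024, §2 eq. (5)] -/
theorem z2_hasAreaLawWith_of_mem_limitPoints (hd : 2 ≤ d) {β : ℝ} (hβ : 0 ≤ β)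
    (hpos : 0 < 2 * ((d - 1 : ℕ) : ℝ) * β) {μ : Measure (LGConfig d (Multiplicative (ZMod 2)))}
    (hμ : μ ∈ infiniteVolumeLimitPoints z2Rep β) :
    HasAreaLawWith μ (fun g => normalisedCharacter 1 (z2Rep g)) 1
      (-Real.log (2 * ((d - 1 : ℕ) : ℝ) * β)) := by
  intro R T hR hT
  have hev : ∀ᶠ L : ℕ in Filter.atTop, |wilsonExpectation (L := L + 1) z2Rep β
      (wilsonLoop z2Rep (0 : Site d (L + 1)) 0 1 R T)| ≤
        (1 : ℝ) ^ (2 * (R + T)) * Real.exp (-(-Real.log (2 * ((d - 1 : ℕ) : ℝ) * β)) * R * T) := by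
    filter_upwards [Filter.eventually_ge_atTop (2 * R + 2 * T)] with L hL
    haveI : Fact (1 < L + 1) := ⟨by omega⟩
    rw [one_pow, one_mul, abs_of_nonneg (z2_wilsonExpectation_wilsonLoop_nonneg hβ _ 0 1 R T), mul_assoc]
    exact z2_wilsonExpectation_wilsonLoop_le_exp hβ hpos _ (fin_zero_ne_one' hd) (by omega) (by omega)
  exact abs_rectExpectation_le_of_eventually z2Rep continuous_of_discreteTopology hμ hev

/-- **String tension of the `ℤ₂` theory at strong coupling**: if a limit state of the `ℤ₂` torus
states at `0 < 2(d-1)β` (`d ≥ 2`) has a string tension `σ`, then `σ ≥ -log(2(d-1)β)` — positive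
for `2(d-1)β < 1` (Mota–Sá Barreto 2024 eq. (5): area decay rate `|ln(2β(d-1))|`).
[cite: MotaSaBarreto2024, §2 eq. (5)] -/
theorem z2_le_stringTension (hd : 2 ≤ d) {β : ℝ} (hβ : 0 ≤ β) (hpos : 0 < 2 * ((d - 1 : ℕ) : ℝ) * β)
    {μ : Measure (LGConfig d (Multiplicative (ZMod 2)))} (hμ : μ ∈ infiniteVolumeLimitPoints z2Rep β)
    {σ : ℝ} (hσ : HasStringTension μ (fun g => normalisedCharacter 1 (z2Rep g)) σ) :
    -Real.log (2 * ((d - 1 : ℕ) : ℝ) * β) ≤ σ :=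
  (z2_hasAreaLawWith_of_mem_limitPoints hd hβ hpos hμ).le_of_hasStringTension hσ

/-- **Explicit area law for the `SU(2)` limit states at strong coupling**: for `d ≥ 2`,
`0 < β`, every infinite-volume limit point `μ` of the `SU(2)` torus Wilson states satisfies
`|W_μ(R,T)| ≤ e^{log(4(d-1)β) RT}` for all `R, T ≥ 1` (centre domination
`|⟨W⟩_{SU(2),β,L}| ≤ ⟨W⟩_{ℤ₂,2β,L}`, Grosse 1988 (4.134), composed with the Griffiths-inequality
bound for `ℤ₂` at `2β`, and passed to the limit). [cite: Grosse1988, §4.2.4 eq. (4.134)] -/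
theorem su2_hasAreaLawWith_of_mem_limitPoints (hd : 2 ≤ d) {β : ℝ} (hβ : 0 < β)
    {μ : Measure (LGConfig d (Matrix.specialUnitaryGroup (Fin 2) ℂ))}
    (hμ : μ ∈ infiniteVolumeLimitPoints (fundamentalRep (Fin 2)) β) :
    HasAreaLawWith μ (fun g => normalisedCharacter 2 (fundamentalRep (Fin 2) g)) 1
      (-Real.log (4 * ((d - 1 : ℕ) : ℝ) * β)) := by
  have hd1 : (1 : ℝ) ≤ ((d - 1 : ℕ) : ℝ) := by exact_mod_cast (show 1 ≤ d - 1 by omega)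
  have hpos : 0 < 2 * ((d - 1 : ℕ) : ℝ) * (2 * β) := by positivity
  intro R T hR hT
  have hev : ∀ᶠ L : ℕ in Filter.atTop, |wilsonExpectation (L := L + 1) (fundamentalRep (Fin 2)) β
      (wilsonLoop (fundamentalRep (Fin 2)) (0 : Site d (L + 1)) 0 1 R T)| ≤
        (1 : ℝ) ^ (2 * (R + T)) * Real.exp (-(-Real.log (4 * ((d - 1 : ℕ) : ℝ) * β)) * R * T) := by
    filter_upwards [Filter.eventually_ge_atTop (2 * R + 2 * T)] with L hL
    haveI : Fact (1 < L + 1) := ⟨by omega⟩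
    rw [one_pow, one_mul, mul_assoc,
      show (4 : ℝ) * ((d - 1 : ℕ) : ℝ) * β = 2 * ((d - 1 : ℕ) : ℝ) * (2 * β) by ring]
    exact (su2_abs_wilsonExpectation_wilsonLoop_le_z2 hβ.le _ 0 1 R T).trans
      (z2_wilsonExpectation_wilsonLoop_le_exp (by positivity) hpos _ (fin_zero_ne_one' hd)
        (by omega) (by omega))
  exact abs_rectExpectation_le_of_eventually (fundamentalRep (Fin 2)) (continuous_fundamentalRep (Fin 2)) hμ hev

/-- **String tension of `SU(2)` at strong coupling, explicit**: if an infinite-volume limit state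
of the `SU(2)` torus Wilson states at `0 < β` (`d ≥ 2`) has a string tension `σ`, then
`σ ≥ -log(4(d-1)β)` — positive for `β < 1/(4(d-1))` (`d = 4`: `σ ≥ log(1/(12β))`); cf. the
tree's `exists_z2_limitPoint_staticPotential_le` (string tension inherited from the centre) —
here the centre theory's area law is supplied by Griffiths inequalities.
[cite: Grosse1988, §4.2.4 (text after eq. (4.134))] -/
theorem su2_le_stringTension (hd : 2 ≤ d) {β : ℝ} (hβ : 0 < β)
    {μ : Measure (LGConfig d (Matrix.specialUnitaryGroup (Fin 2) ℂ))}
    (hμ : μ ∈ infiniteVolumeLimitPoints (fundamentalRep (Fin 2)) β) {σ : ℝ}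
    (hσ : HasStringTension μ (fun g => normalisedCharacter 2 (fundamentalRep (Fin 2) g)) σ) :
    -Real.log (4 * ((d - 1 : ℕ) : ℝ) * β) ≤ σ :=
  (su2_hasAreaLawWith_of_mem_limitPoints hd hβ hμ).le_of_hasStringTension hσ

end StringTension

end Literature.MathematicalPhysics.QuantumFieldTheory
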